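import Summits.ResolutionOfSingularities.ResolutionOfSingularities.Theorems.PurelyInseparableDim4E2OfCJSLocalizeProof
import Summits.ResolutionOfSingularities.ResolutionOfSingularities.Theorems.PurelyInseparableDim4StrictTransformBlowup
import HarnessLib
import HarnessLib.Audit.Tags

/-!
# F4-I(3,3) from CJS — (M-c) `E2OfCJS.StrictTransformBlowup` ASSEMBLED from three local inputs

Cell `res-dim4-pi`, E2(3,3) transfer row, sub-row (M-c) (desk WORD #59 (a) / #62; holder p-2 g2, (M-b) owner p-7 g2).
The frozen target `E2OfCJS.StrictTransformBlowup` (p667552) quantifies over an ARBITRARY locally noetherian ambient `Z`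
with only CHART-LOCAL data at the blown-up point `x` (an open-immersion chart `φ : 𝔸⁵ ⟶ Z` reading `M.ideal` as
`(z³ + F)·𝒪`).  The universal-property half is the any-weight restriction property already in the tree
(`StrictTransformBlowup.isBlowup_subscheme_controlledTransform_of_isEffectiveCartier`, p666342); what it needs is LOCAL:

* **(SB1) `TransformLePow`** — `M.ideal ⊆ 𝓘_x ^ 3` (order `3` at `x` read through the chart; trivial off `x`);
* **(SB2) `TransformColonStable`** — the transformed ideal `M'.ideal = πᶜ(M.ideal, 3)` is `𝓘_E`-colon-stable,
  `(M'.ideal : 𝓘_E) ⊆ M'.ideal` (off `E` trivially; over the chart, `Z'` is regular and Kollár 3.30.2 — tree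
  `IsBlowup.strictTransformIdeal_eq_controlledTransform` on the restricted blow-up — applies);
* **(SB3) `CentreOnSubscheme`** — `𝓘_x` restricted to `V(M.ideal)` is the ideal of the closed point `y` over `x`.

This file states the three inputs as `Prop`s with EXACTLY the binders of `StrictTransformBlowup` and PROVES the
assembly `strictTransformBlowup_of : TransformLePow → TransformColonStable → CentreOnSubscheme → StrictTransformBlowup`
(`exists_hom_subscheme_controlledTransform_weight` for `ρ`, `isEffectiveCartier_comap_subschemeι_of_colon_le` for the
Cartier restriction, the universal property, then the centre conversion).  The three inputs are the live targets
(SB2 = p-5 g2; SB1/SB3 offered by exact signature on the bus).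
[cite: Kollar2007, 3.30.2] [cite: BierstoneGrigorievMilmanWlodarczyk2011, §4 Remark (3)]
OURS · counted 0 · the three `Prop`s are OURS, untagged, NOT asserted; nothing here proves `StrictTransformBlowup`,
`LocalizationRow`, E2(3,3), or resolution of singularities in dimension `≥ 4` / characteristic `p`.
Supports stmt-ResolutionOfSingularities-16155 (helper).  bears_on: LADDER-RESOLUTION:D157-DOOR2 (res-dim4-pi · E2 · M-c).
-/

set_option linter.dupNamespace false -- mandated namespace of this single-conjunct summit

noncomputable section

open CategoryTheory CategoryTheory.Limits AlgebraicGeometry TopologicalSpace IsLocalRing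
open Literature.AlgebraicGeometry.Resolution
open Literature.AlgebraicGeometry.Resolution.Hauser2010
open Literature.AlgebraicGeometry.Resolution.AffinePointBlowup (P A ξ)
open Scheme.IdealSheafData

namespace Summit.ResolutionOfSingularities.ResolutionOfSingularities.Theorems.PIDim4

namespace E2OfCJS

/-- **(SB1) ORDER THREE AT THE CENTRE**: in the situation of `StrictTransformBlowup`, `M.ideal ⊆ 𝓘_x ^ 3` (the stalk of
`M.ideal` at `x` is `(z³ + F)·𝒪_{𝔸⁵,0}` with `ordZero F = 3`, and `𝓘_x ^ 3` is the unit ideal off `x`).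
(OURS row — parameterless `Prop`, deliberately untagged; not asserted.) -/
def TransformLePow : Prop :=
  ∀ (K : Type) [Field K] (F : MvPolynomial (Fin 4) K) (Z : Scheme.{0}) [IsLocallyNoetherian Z]
    (M : MarkedIdeal Z) (x : Z) (hx : IsClosed ({x} : Set Z)) (φ : P 4 K ⟶ Z) [IsOpenImmersion φ],
    M.mult = 3 → ordZero F = (3 : ℕ∞) → φ (ξ 4 K) = x → M.ideal.comap φ = hypSheaf 3 F →
      M.ideal ≤ vanishingIdeal ⟨{x}, hx⟩ ^ 3

/-- **(SB2) COLON-STABILITY OF THE TRANSFORM**: in the situation of `StrictTransformBlowup`, the transformed ideal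
`M'.ideal = πᶜ(M.ideal, 3)` satisfies `(M'.ideal : 𝓘_E) ⊆ M'.ideal`, `𝓘_E = 𝓘_x·𝒪_{Z'}` (the local equation of the
exceptional divisor is a nonzerodivisor modulo the strict transform of the hypersurface).
(OURS row — parameterless `Prop`, deliberately untagged; not asserted.) -/
def TransformColonStable : Prop :=
  ∀ (K : Type) [Field K] (F : MvPolynomial (Fin 4) K) (Z Z' : Scheme.{0}) [IsLocallyNoetherian Z]
    [IsLocallyNoetherian Z'] (M : MarkedIdeal Z) (M' : MarkedIdeal Z') (x : Z) (hx : IsClosed ({x} : Set Z))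
    (φ : P 4 K ⟶ Z) [IsOpenImmersion φ] (π : Z' ⟶ Z),
    M.mult = 3 → ordZero F = (3 : ℕ∞) → φ (ξ 4 K) = x → M.ideal.comap φ = hypSheaf 3 F →
    IsBlowup π (vanishingIdeal ⟨{x}, hx⟩) → M' = M.transform π (vanishingIdeal ⟨{x}, hx⟩) →
      colon M'.ideal ((vanishingIdeal ⟨{x}, hx⟩).comap π) ≤ M'.ideal

/-- **(SB3) THE CENTRE ON THE HYPERSURFACE**: `𝓘_x` pulled back to the closed subscheme `V(M.ideal)` is the ideal of
the (unique, closed) point `y` over `x`. (OURS row — parameterless `Prop`, deliberately untagged; not asserted.) -/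
def CentreOnSubscheme : Prop :=
  ∀ (Z : Scheme.{0}) [IsLocallyNoetherian Z] (I : Z.IdealSheafData) (x : Z) (hx : IsClosed ({x} : Set Z))
    (y : I.subscheme) (hy : IsClosed ({y} : Set I.subscheme)), I.subschemeι y = x →
      (vanishingIdeal ⟨{x}, hx⟩).comap I.subschemeι = vanishingIdeal ⟨{y}, hy⟩

/-- **(M-c) ASSEMBLED: `TransformLePow → TransformColonStable → CentreOnSubscheme → StrictTransformBlowup`.**
The morphism `ρ : V(M'.ideal) ⟶ V(M.ideal)` over `π` exists (`π^*M.ideal ⊆ M'.ideal`); the exceptional divisor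
restricts to an effective Cartier divisor on `V(M'.ideal)` by colon-stability (SB2); with `M.ideal ⊆ 𝓘_x^3` (SB1) the
universal property of `π` makes `ρ` a blow-up of `V(M.ideal)` along `𝓘_x|_{V(M.ideal)}`
(`StrictTransformBlowup.isBlowup_subscheme_controlledTransform_of_isEffectiveCartier`), which is the ideal of the point
over `x` (SB3). [cite: Kollar2007, 3.30.2] [cite: BierstoneGrigorievMilmanWlodarczyk2011, §4 Remark (3)] -/
theorem strictTransformBlowup_of (h1 : TransformLePow) (h2 : TransformColonStable) (h3 : CentreOnSubscheme) :
    StrictTransformBlowup := by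
  intro K _ F Z Z' _ _ M M' x hx φ _ π hmult hF hφx hMφ hπ hM'
  -- the three inputs at this datum
  have hle : M.ideal ≤ vanishingIdeal ⟨{x}, hx⟩ ^ M.mult := by
    rw [hmult]
    exact h1 K F Z M x hx φ hmult hF hφx hMφ
  have hcol : colon M'.ideal ((vanishingIdeal ⟨{x}, hx⟩).comap π) ≤ M'.ideal :=
    h2 K F Z Z' M M' x hx φ π hmult hF hφx hMφ hπ hM'
  subst hM'
  -- `M'.ideal` is the controlled transform with weight `M.mult`
  have hT : (M.transform π (vanishingIdeal ⟨{x}, hx⟩)).ideal =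
      controlledTransform π (vanishingIdeal ⟨{x}, hx⟩) M.ideal M.mult := rfl
  obtain ⟨ρ, hρ⟩ := StrictTransformBlowup.exists_hom_subscheme_controlledTransform_weight π
    (vanishingIdeal ⟨{x}, hx⟩) M.ideal M.mult
  refine ⟨ρ, hρ, fun y hy hyx => ?_⟩
  have hE : IsEffectiveCartier (((vanishingIdeal ⟨{x}, hx⟩).comap π).comap
      (controlledTransform π (vanishingIdeal ⟨{x}, hx⟩) M.ideal M.mult).subschemeι) :=
    StrictTransformBlowup.isEffectiveCartier_comap_subschemeι_of_colon_le hπ.isEffectiveCartier hcol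
  have hB := StrictTransformBlowup.isBlowup_subscheme_controlledTransform_of_isEffectiveCartier hπ hle hE ρ hρ
  rwa [h3 Z M.ideal x hx y hy hyx] at hB

end E2OfCJS

end Summit.ResolutionOfSingularities.ResolutionOfSingularities.Theorems.PIDim4

end
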